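import Literature.NumberTheory.LFunctions.Zhang2022.EllRegimeStatements
import HarnessLib

/-!
# Zhang (2022) in the `ℓ`-regime: the tie/CS-sheet endgame for ARBITRARY value tables / profile designs
# (design-agnostic kernel sentence for the B-ell PPE classes G5/G6 and the §E intake; cell `landau-siegel`)

Topic `Literature/NumberTheory/LFunctions/Zhang2022` (Landau–Siegel audit tree; verdict-neutral).
Y. Zhang, *Discrete mean estimates and the Landau–Siegel zero*, arXiv:2211.02515v1 [Zhang2022LandauSiegel] —
an unrefereed manuscript under adjudication. **WHAT THIS IS NOT: not a claim about Theorems 1–2 of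
arXiv:2211.02515, about Landau–Siegel zeros, or about Parity. The `def … : Prop`s are NAMED STATEMENTS asserted
by no one; the `theorem`s are PROVED bookkeeping (Cauchy's inequality, (2.18)) and the resulting implication.**

WHY THIS FILE.  Part 8 of `EllRegimeStatements` proves the Cauchy–Schwarz endgame at fixed `A` for designs given
by a `Repair.Theta` record (the class-`R` parametrisation: `H₁, H₂` from `h1Profile/h2Profile`, the tied tent).
The cell's live CS designs are more general — σ′-deformed multi-piece PPE profiles (sub-families G5/G6, block C of
B-ell/KILL-draft §2), and the §E barrier clause quantifies over such classes.  The analytic content of the endgame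
does not see the parametrisation: it needs four VALUE TABLES `(u₁, u₂; v₁, v₂) = (H₁, H₂; J₁, J₂)` on `Ψ × zeros`
at each scale record, real non-negative weights (Lemma 2.3 + Prop. 2.2 (i)), `|Z(ρ,ψχ)| = 1`, and dictionary bounds
for the five normalised quantities `Ξ₁/(𝔞𝔓)`, `Ξ_J/(𝔞𝔓)`, `Ξ₁₂/(𝔞𝔓)`, `Ξ₁*/(𝔞𝔓)`, `(11.1)/(𝔞𝔓)`.  This file states
and proves exactly that:

* `norm_xiStar1At_div_le` — (2.18) + Cauchy NORMALISED for arbitrary tables (the table-generic form of Part 8's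
  `norm_crossStar_le`): `‖Ξ₁*/N‖ ≤ √(Ξ(u₁+Zū₂)/N · Ξ(v₁)/N) + √(Ξ(v₁−Zv̄₂)/N · Ξ(u₂)/N)`, `N = 𝔞𝔓 ≥ 0`;
* `CSDictTablesAt` — the five dictionary inequalities at one scale record for given tables and given dictionary
  values `(m_D, m_J, m₂, X, δ)` with tolerance `tol`; `csDictTablesAt_contra` — with real non-negative weights and
  `|Z| = 1`, they are INCOMPATIBLE with the certificate `√((m_D+tol)⁺(m_J+tol)⁺) + √(δ⁺(m₂+tol)⁺) < ‖X‖ − tol` (PROVED);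
* `profTable` (tables from a profile polynomial), the fixed-`(A,B)` row `EllCSDictProfiles` for a design given by
  four scale-dependent profiles/lengths with `λ`-dependent dictionary values, and the PROVED endgame
  `forAllLarge_not_assumptionA_of_csProfiles` / `theorem1_of_csProfiles` (row + `Lemma23FixedA` + `EllZeroModelFixedA`
  + certificate `∀|λ| ≤ Λ` ⇒ `¬(A)` eventually ⇒ Theorem 1) — the Theta-free twin of `theorem1_of_ellCSDict`.

## References
* Y. Zhang, arXiv:2211.02515v1 (2022): §2 (2.16)–(2.20) p. 5, Props. 2.4–2.6, (2.32)–(2.33) p. 6; §8 (8.2);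
  §10 (10.17); §11 (11.1). [cite: Zhang2022LandauSiegel, §2 (2.16)–(2.20), (2.32)–(2.33), Props. 2.4–2.6]

«The programme SEARCHES and TYPES; no claim about Landau–Siegel zeros, Theorems 1–2 of arXiv:2211.02515
or a repaired Margin232 until a kernel theorem says so.»
-/

noncomputable section

open Complex Real ComplexConjugate

namespace Literature.NumberTheory.LFunctions.Zhang2022

namespace EllRegime

open EllScales Repair Skeleton

section Generic

variable {D : ℕ} [NeZero D] (χ : DirichletCharacter ℂ D)

/-- The value table of a profile polynomial at scale `S`: `(ψ, ρ) ↦ Σ_{n<N} ψχ(n)g(log n/log P)n^{−ρ}`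
(`EllScales.profPoly`). [cite: Zhang2022LandauSiegel, §2 (2.23)–(2.29)] -/
def profTable {S : Scales} (g : ℝ → ℂ) (N : ℕ) : Chr S → ℂ → ℂ :=
  fun x ρ => profPoly χ x g N ρ

/-- **The tie/CS dictionary inequalities at one scale record, for ARBITRARY tables** `(u₁, u₂; v₁, v₂)` and given
dictionary values: `Ξ(u₁+Zū₂)/N ≤ m_D + tol` ((2.32)-side), `Ξ(v₁)/N ≤ m_J + tol` ((2.33)-side), `Ξ(u₂)/N ≤ m₂ + tol`
((9.7)-side), `‖Ξ₁*/N − X‖ ≤ tol` ((10.17)-side), `Ξ(v₁−Zv̄₂)/N ≤ δ` ((11.1)-side), `N = 𝔞𝔓`.  A DEFINITION.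
[cite: Zhang2022LandauSiegel, §2 (2.17), (2.32)–(2.33); §9 (9.7); §10 (10.17); §11 (11.1)] -/
def CSDictTablesAt (c' : ℝ) (S : Scales) (F : Finset (Chr S)) (u₁ u₂ v₁ v₂ : Chr S → ℂ → ℂ)
    (mD mJ m₂ : ℝ) (X : ℂ) (δ tol : ℝ) : Prop :=
  discMean c' S F (twoSided χ u₁ u₂) / normaliser χ S ≤ mD + tol ∧
  discMean c' S F v₁ / normaliser χ S ≤ mJ + tol ∧
  discMean c' S F u₂ / normaliser χ S ≤ m₂ + tol ∧
  ‖xiStar1At c' S F u₁ u₂ v₁ v₂ / (normaliser χ S : ℂ) - X‖ ≤ tol ∧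
  discMean c' S F (afeDefect χ v₁ v₂) / normaliser χ S ≤ δ

variable {χ}

/-- `√(a/N · b/N)·N = √(ab)` for `N > 0`. [folklore] -/
private theorem sqrt_div_mul_self' {a b N : ℝ} (hN : 0 < N) :
    Real.sqrt (a / N * (b / N)) * N = Real.sqrt (a * b) := by
  rw [div_mul_div_comm, Real.sqrt_div' _ (mul_self_nonneg N), Real.sqrt_mul_self hN.le,
    div_mul_cancel₀ _ hN.ne']

/-- **(2.18) + Cauchy, normalised, for arbitrary tables — PROVED**: with real non-negative weights and `|Z| = 1` at
the sampled zeros, `‖Ξ₁*/N‖ ≤ √(Ξ(u₁+Zū₂)/N · Ξ(v₁)/N) + √(Ξ(v₁−Zv̄₂)/N · Ξ(u₂)/N)` (`N = 𝔞𝔓 ≥ 0`; all terms `0`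
when `N = 0`).  Table-generic form of `norm_crossStar_le`. [cite: Zhang2022LandauSiegel, §2 (2.18), p. 6; §11 p. 23] -/
theorem norm_xiStar1At_div_le {c' : ℝ} {S : Scales} {F : Finset (Chr S)} (hw : WeightsNonnegAt c' S F)
    (hr : RealWeightsAt c' S F) (hZ : UnitRootAt χ S F) (u₁ u₂ v₁ v₂ : Chr S → ℂ → ℂ) :
    ‖xiStar1At c' S F u₁ u₂ v₁ v₂ / (normaliser χ S : ℂ)‖ ≤
      Real.sqrt (discMean c' S F (twoSided χ u₁ u₂) / normaliser χ S * (discMean c' S F v₁ / normaliser χ S)) +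
        Real.sqrt (discMean c' S F (afeDefect χ v₁ v₂) / normaliser χ S *
          (discMean c' S F u₂ / normaliser χ S)) := by
  have hN := normaliser_nonneg χ S
  rcases hN.eq_or_lt with hN0 | hNpos
  · rw [← hN0]
    simp
  · have h218 := norm_xiStar1At_le hw hr hZ u₁ u₂ v₁ v₂
    have h2 : xiStar2At χ c' S F u₁ u₂ v₁ ≤
        Real.sqrt (discMean c' S F (twoSided χ u₁ u₂) * discMean c' S F v₁) :=
      (Real.le_sqrt (absPairing_nonneg hw _ _)
        (mul_nonneg (discMean_nonneg_of_weights hw _) (discMean_nonneg_of_weights hw _))).mpr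
        (absPairing_sq_le hw _ _)
    have h3 : xiStar3At χ c' S F u₂ v₁ v₂ ≤
        Real.sqrt (discMean c' S F (afeDefect χ v₁ v₂) * discMean c' S F u₂) :=
      (Real.le_sqrt (absPairing_nonneg hw _ _)
        (mul_nonneg (discMean_nonneg_of_weights hw _) (discMean_nonneg_of_weights hw _))).mpr
        (absPairing_sq_le hw _ _)
    rw [norm_div, Complex.norm_real, Real.norm_of_nonneg hN, div_le_iff₀ hNpos, add_mul,
      sqrt_div_mul_self' hNpos, sqrt_div_mul_self' hNpos]
    linarith

/-- **One-scale contradiction for arbitrary tables, PROVED:** real non-negative weights, `|Z| = 1`, the five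
dictionary inequalities `CSDictTablesAt … m_D m_J m₂ X δ tol`, and the certificate
`√((m_D+tol)⁺·(m_J+tol)⁺) + √(δ⁺·(m₂+tol)⁺) < ‖X‖ − tol` cannot hold together.
[cite: Zhang2022LandauSiegel, §2 p. 6 (Props. 2.4–2.6, (2.18))] -/
theorem csDictTablesAt_contra {c' : ℝ} {S : Scales} {F : Finset (Chr S)} {u₁ u₂ v₁ v₂ : Chr S → ℂ → ℂ}
    {mD mJ m₂ : ℝ} {X : ℂ} {δ tol : ℝ} (hw : WeightsNonnegAt c' S F) (hr : RealWeightsAt c' S F)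
    (hZ : UnitRootAt χ S F) (h : CSDictTablesAt χ c' S F u₁ u₂ v₁ v₂ mD mJ m₂ X δ tol)
    (hcert : Real.sqrt (max (mD + tol) 0 * max (mJ + tol) 0) + Real.sqrt (max δ 0 * max (m₂ + tol) 0) <
      ‖X‖ - tol) : False := by
  obtain ⟨hDm, hJm, h2m, hXm, hfm⟩ := h
  have hN := normaliser_nonneg χ S
  have hchain := norm_xiStar1At_div_le hw hr hZ u₁ u₂ v₁ v₂
  have h0J : 0 ≤ discMean c' S F v₁ / normaliser χ S := div_nonneg (discMean_nonneg_of_weights hw _) hN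
  have h02 : 0 ≤ discMean c' S F u₂ / normaliser χ S := div_nonneg (discMean_nonneg_of_weights hw _) hN
  have hX : ‖X‖ - tol ≤ ‖xiStar1At c' S F u₁ u₂ v₁ v₂ / (normaliser χ S : ℂ)‖ := by
    have := norm_sub_norm_le X (xiStar1At c' S F u₁ u₂ v₁ v₂ / (normaliser χ S : ℂ))
    rw [norm_sub_rev] at this
    linarith
  exact cs_contra h0J h02 hchain hDm hJm h2m hfm hX hcert

/-- **The tie/CS dictionary at `(A, B)` for a design given by PROFILES** (side 1: `g₁` of length `N₁`; side 2: `g₂`,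
`N₂`; probe `f₁`, `M₁`; its functional-equation dual `f₂`, `M₂` — each a function of the scale record, so that
`T`-lengths, frame rules and the `α̃`-shift of `J₂` are the caller's), with dictionary values `m_D, m_J, m₂, X`
depending on `(S, λ)` and the defect bound `δ(S)`: eventually in `D`, under (A), for SOME `|λ| ≤ Λ`, at every record of
the regime `(D^A, D^B)`, `CSDictTablesAt` holds on `Fam S` with tolerance `tol`.  Design-agnostic twin of
`EllCSDictLam` (whose Theta instance has `m_D = C₂₃₂^{(ℓ(P))} + …`, `tol = K/A²`).  A DEFINITION; asserted for no data.
[cite: Zhang2022LandauSiegel, §2 (2.17), (2.23)–(2.30), (2.32)–(2.33), Props. 2.4–2.6; §10 (10.17); §11 (11.1)] -/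
def EllCSDictProfiles (c' : ℝ) (Fam : (S : Scales) → Finset (Chr S)) (g₁ g₂ f₁ f₂ : Scales → ℝ → ℂ)
    (N₁ N₂ M₁ M₂ : Scales → ℕ) (mD mJ m₂ : Scales → ℝ → ℝ) (X : Scales → ℝ → ℂ) (δ : Scales → ℝ)
    (Λ tol A B : ℝ) : Prop :=
  ForAllLarge fun D _ χ => AssumptionA D χ → ∃ lam : ℝ, |lam| ≤ Λ ∧
    ∀ S : Scales, S.D = D → S.IsEllRegime A B →
      CSDictTablesAt χ c' S (Fam S) (profTable χ (g₁ S) (N₁ S)) (profTable χ (g₂ S) (N₂ S))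
        (profTable χ (f₁ S) (M₁ S)) (profTable χ (f₂ S) (M₂ S)) (mD S lam) (mJ S lam) (m₂ S lam) (X S lam)
        (δ S) tol

/-- **THE CAUCHY–SCHWARZ ENDGAME AT `(A, B)` FOR A PROFILE DESIGN, PROVED** (Theta-free twin of
`forAllLarge_not_assumptionA_of_csDict`): the row `EllCSDictProfiles … Λ tol A B`, Lemma 2.3 at fixed `A`
(`Lemma23FixedA` from `A₁ ≤ A`), the zero model (`EllZeroModelFixedA` from `A₂ ≤ A`), `A ≥ 1`, and a certificate
`√((m_D+tol)⁺(m_J+tol)⁺) + √(δ⁺(m₂+tol)⁺) < ‖X‖ − tol` at every large-`D` record for EVERY `|λ| ≤ Λ` give `¬(A)`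
eventually. [cite: Zhang2022LandauSiegel, §2 p. 6, (2.17)–(2.20), (2.32)–(2.33), Props. 2.4–2.6] -/
theorem forAllLarge_not_assumptionA_of_csProfiles {c' : ℝ} {Fam : (S : Scales) → Finset (Chr S)}
    {g₁ g₂ f₁ f₂ : Scales → ℝ → ℂ} {N₁ N₂ M₁ M₂ : Scales → ℕ} {mD mJ m₂ : Scales → ℝ → ℝ}
    {X : Scales → ℝ → ℂ} {δ : Scales → ℝ} {Λ tol A B A₁ cZ A₂ : ℝ}
    (hdict : EllCSDictProfiles c' Fam g₁ g₂ f₁ f₂ N₁ N₂ M₁ M₂ mD mJ m₂ X δ Λ tol A B)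
    (h23 : Lemma23FixedA c' Fam A₁) (hZ : EllZeroModelFixedA Fam cZ A₂) (h1 : A₁ ≤ A) (h2 : A₂ ≤ A)
    (hA : 1 ≤ A)
    (hcert : ∃ D₁ : ℕ, ∀ S : Scales, D₁ ≤ S.D → S.IsEllRegime A B → ∀ lam : ℝ, |lam| ≤ Λ →
      Real.sqrt (max (mD S lam + tol) 0 * max (mJ S lam + tol) 0) +
          Real.sqrt (max (δ S) 0 * max (m₂ S lam + tol) 0) < ‖X S lam‖ - tol) :
    ForAllLarge fun D _ χ => ¬ AssumptionA D χ := by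
  obtain ⟨C, hZ⟩ := hZ
  obtain ⟨D₁, hcert⟩ := hcert
  have hev := ((hdict.and (h23 A h1)).and (hZ A h2)).and
    (ForAllLarge.of_le (S := fun D _ _ => max D₁ 3 ≤ D) (max D₁ 3) fun D _ χ hD _ _ => hD)
  refine hev.mono fun D _ χ _ hχp hall hA' => ?_
  obtain ⟨⟨⟨hd, h23D⟩, hZD⟩, hD⟩ := hall
  have hD3 : 3 ≤ D := le_trans (le_max_right _ _) hD
  set S := KnifeEdge.scalesAt A B D with hSdef
  have hreg : S.IsEllRegime A B := ⟨⟨rfl, rfl, rfl, rfl, rfl⟩, rfl⟩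
  have hregP : S.IsEllRegimeP A := hreg.1
  have hSD : S.D = D := rfl
  have hD1 : D₁ ≤ S.D := le_trans (le_max_left _ _) hD
  have hL2 : 0 < S.L2 := by
    show 0 < Real.log (D : ℝ) ^ 400
    exact pow_pos (by linarith [one_le_log_of_three_le hD3]) _
  obtain ⟨lam, hlam, hdS⟩ := hd hA'
  have hrow := hdS S hSD hreg
  have hline := (hZD hA' S hSD hregP).2.1
  have h23S := h23D hA' S hSD hregP
  have hw : WeightsNonnegAt c' S (Fam S) := weightsNonnegAt_of hL2 h23S hline
  have hr : RealWeightsAt c' S (Fam S) := realWeightsAt_of hL2 h23S hline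
  have hU : UnitRootAt χ S (Fam S) := unitRootAt_scalesAt hχp hD3 hA hline
  exact csDictTablesAt_contra hw hr hU hrow (hcert S hD1 hreg lam hlam)

/-- **… hence Theorem 1** from a profile design's CS rows + certificate. [cite: Zhang2022LandauSiegel, §1 Theorem 1; §2 p. 6] -/
theorem theorem1_of_csProfiles {c' : ℝ} {Fam : (S : Scales) → Finset (Chr S)}
    {g₁ g₂ f₁ f₂ : Scales → ℝ → ℂ} {N₁ N₂ M₁ M₂ : Scales → ℕ} {mD mJ m₂ : Scales → ℝ → ℝ}
    {X : Scales → ℝ → ℂ} {δ : Scales → ℝ} {Λ tol A B A₁ cZ A₂ : ℝ}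
    (hdict : EllCSDictProfiles c' Fam g₁ g₂ f₁ f₂ N₁ N₂ M₁ M₂ mD mJ m₂ X δ Λ tol A B)
    (h23 : Lemma23FixedA c' Fam A₁) (hZ : EllZeroModelFixedA Fam cZ A₂) (h1 : A₁ ≤ A) (h2 : A₂ ≤ A)
    (hA : 1 ≤ A)
    (hcert : ∃ D₁ : ℕ, ∀ S : Scales, D₁ ≤ S.D → S.IsEllRegime A B → ∀ lam : ℝ, |lam| ≤ Λ →
      Real.sqrt (max (mD S lam + tol) 0 * max (mJ S lam + tol) 0) +
          Real.sqrt (max (δ S) 0 * max (m₂ S lam + tol) 0) < ‖X S lam‖ - tol) :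
    Theorem1 :=
  Skeleton.theorem1_of_eventually_not_assumptionA
    (forAllLarge_not_assumptionA_of_csProfiles hdict h23 hZ h1 h2 hA hcert)

/-- **The POS-sheet twin for a profile design** (any table, one scale): with non-negative weights the normalised
mean of ANY table is `≥ 0`, so a dictionary bound `Ξ(u)/N ≤ m + tol` with `m + tol < 0` is contradictory — the
design-agnostic form of Part 5's positivity endgame step. [cite: Zhang2022LandauSiegel, §2 (2.16), Lemma 2.3, (2.15)] -/
theorem posDictAt_contra {c' : ℝ} {S : Scales} {F : Finset (Chr S)} {u : Chr S → ℂ → ℂ} {m tol : ℝ}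
    (hw : WeightsNonnegAt c' S F) (h : discMean c' S F u / normaliser χ S ≤ m + tol) (hneg : m + tol < 0) :
    False := by
  have h0 : 0 ≤ discMean c' S F u / normaliser χ S :=
    div_nonneg (discMean_nonneg_of_weights hw _) (normaliser_nonneg χ S)
  linarith

end Generic

end EllRegime

end Literature.NumberTheory.LFunctions.Zhang2022

end
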